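import Literature.Probability.LatticeModels.PlaneRotatorGinibreComparison
import Literature.Probability.LatticeModels.GaussianPairingBoundCouplings
import HarnessLib

/-!
# Aizenman–Simon's comparison of plane-rotor and Ising two-point functions (named fact)

Topic `Literature/Probability/LatticeModels`. M. Aizenman, B. Simon, *A comparison of plane rotor and
Ising models*, Phys. Lett. **76A** (1980) 281–282 [AizenmanSimon1980RotorIsing], eq. (1): for Ising spins
`σ_α = ±1` with a ferromagnetic pair Hamiltonian `H = −∑ J_{αγ} σ_α σ_γ`, `J ≥ 0`, at inverse
temperature `β` (expectation `⟨·⟩_{β,1}`), and two-component uniformly distributed unit vectors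
`s⃗_α = (cos θ_α, sin θ_α)` with `H = −∑ J_{αγ} s⃗_α · s⃗_γ` (same `J`'s) at inverse temperature `2β`
(expectation `⟨·⟩_{2β,2}`),

  `⟨s⃗_α · s⃗_γ⟩_{2β,2} ≤ ⟨σ_α σ_γ⟩_{β,1}`                                   (1)

("The proof of (1) is in two steps, neither of which is new": `⟨s⃗·s⃗⟩_{2β,rotor} ≤ ⟨s⃗·s⃗⟩_{2β,ℤ₄}` by
Ginibre's inequality in a `λ cos 4θ` single-site field, `λ → ∞`, and `⟨s⃗·s⃗⟩_{2β,ℤ₄} = ⟨σσ⟩_{β,Ising}`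
by Suzuki's isomorphism `ℤ₄ ≅` two Ising copies). Consequence (2): `β_c^R ≥ 2β_c^I` for the critical
inverse temperatures defined by loss of exponential decay; in `d = 2` with Onsager's
`β_c^I = ½ln(1+√2)`: `β_c^{KT} ≥ ln(1+√2) = 0.88137…`, i.e. `k_B T_BKT ≤ 1.1346 J`.

Typed here as a finite-volume statement in the tree's vocabularies — rotor side `PlaneRotator.twoPoint`
(`PlaneRotatorGinibreComparison.lean`: couplings on ORDERED pairs, weight `exp(∑_{(x,y)} J(x,y) cos(θ_y − θ_x))`),
Ising side `PairIsing.avg` (`GaussianPairingBoundCouplings.lean`: weight `exp(∑_a ∑_b c_{ab} σ_a σ_b)`,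
free boundary condition, zero field): with the SAME ordered-pair array `c ≥ 0` on both sides, the rotor
couplings are `2c` ("inverse temperature `2β`") and the Ising couplings `c` ("inverse temperature `β`");
diagonal entries are constants in both weights. The paper's argument is a finite-volume one (Ginibre's
inequality and an exact identity), so the finite-volume form is what it proves; infinite-volume states
follow by limits.

STATUS: NAMED FACT (D-0014), not proved here (the `λ → ∞` limit of the `cos 4θ`-field Ginibre
comparison is the part not in the tree; Ginibre monotonicity itself is `ginibreExpect_reChar_mono`).
Use: cell `pub/hubbard-tc`, inventory row B6 / lit THEOREMS-tc T6 last bullet (with the tree's layered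
Ising mean-field bound `LayeredIsingMeanField.lean` and Onsager's `β_c`: `T_c^{XY}(J∥,J⊥) ≤ ½T_c^{Is}(J∥,J⊥)`).

References: [AizenmanSimon1980RotorIsing] eqs. (1)–(2), (4)–(6); J. Ginibre, CMP 16 (1970) 310
[Ginibre1970]; M. Suzuki, Prog. Theor. Phys. 37 (1967) 770.
-/

noncomputable section

namespace Literature.Probability.LatticeModels

namespace PlaneRotator

/-- **Aizenman–Simon 1980, eq. (1): the plane rotor at inverse temperature `2β` is dominated by the
Ising model at inverse temperature `β` with the same couplings.** For every finite set of sites `ι`, every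
array `c ≥ 0` of ordered-pair couplings and all sites `a, b`:

  `⟨cos(θ_a − θ_b)⟩^{rotor}_{2c} ≤ ⟨σ_a σ_b⟩^{Ising}_{c}`,

where the rotor weight is `exp(∑_{(x,y)} 2c_{xy} cos(θ_y − θ_x)) ∏ dθ` (`PlaneRotator.twoPoint (2c)`) and
the Ising weight `exp(∑_x ∑_y c_{xy} σ_x σ_y)` (`PairIsing.avg c`). Named fact (not proved in the tree).
[cite: AizenmanSimon1980RotorIsing, eq. (1)] -/
def AizenmanSimonRotorIsingComparison : Prop :=
  ∀ (ι : Type) [Fintype ι] [DecidableEq ι] [MeasurableSpace Circle] [BorelSpace Circle]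
    (c : ι → ι → ℝ), (∀ x y, 0 ≤ c x y) → ∀ a b : ι,
      twoPoint (fun p : ι × ι => 2 * c p.1 p.2) a b ≤ PairIsing.avg c (spinPair a b)

end PlaneRotator

end Literature.Probability.LatticeModels
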